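import Literature.AlgebraicGeometry.HodgeTheory.CyclicCoverPencilShellInvariance
import Mathlib.Analysis.SpecialFunctions.SmoothTransition
import HarnessLib

/-!
# The pencil slice `{b' = b'₀}` of the regular locus, the cut radius, and restricted self-maps

Family `hodge`, layer `Literature/AlgebraicGeometry/HodgeTheory`; step A3c (definitions) of the programme discharging
`carlsonToledo1999_nodalMeridianLocalMonodromyBound` (crux K1 of
`Summits/HodgeConjecture/HodgeConjecture/Theses/CyclicUnitaryPowers.lean`) by the classical construction of the geometric
monodromy of the nodal pencil `x₃^p = f₁ + c·x₂^p`, `f₁ = x₂^{p−2}x₀x₁ + x₀^p + x₁^p` (Arnold–Gusein-Zade–Varchenko II §1.1,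
§2.1; Milnor §9). The interpolated isotopy of `ShellInterpolatedIsotopyPunctured` is assembled on the **pencil slice**

  `S = {Q ∈ 𝒴°(ℂ) | b_m(Q) = b_m(x₃^p − f₁) for all m ≠ x₂^p}`

(the union of the members of the pencil inside the regular locus `𝒴°(ℂ)` of the universal quaternary family), a closed subset on
which both the model isotopy `chartModelIsotopy` (at its good points) and the fold isotopy act. This file provides:

* `pencilSlice p` — the slice `S`; `isClosed_pencilSlice`; `mem_invariantSet_iff` (`invariantSet = S ∩ {s₁² < F}`);
* `continuous_pencilCoord`, `continuous_satRadius`, `satRadius_nonneg`;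
* `cutRadius p Θ R''' R'' T ρW` — the radius function fed to the shell interpolation:
  `max (F(Q)) (T · σ(4|c(Q)|/ρW − 1))` with `σ` the smooth transition; it equals the saturated Morse radius `F` over the
  small disc `|c| ≤ ρW/4` (`cutRadius_eq_of_norm_le`) and is `≥ T` off the disc `|c| < ρW/2` (`norm_lt_of_cutRadius_lt`), so that
  the ball `{cutRadius < T}` only contains points at which the model isotopy is defined; `continuous_cutRadius`;
* `restrictIf s f` — a self-map of `s` agreeing with `f` wherever `f` stays in `s` (`restrictIf_coe`), used to read the two
  isotopies as self-maps of the slice.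

Everything is proved; the three definitions are concrete; no named facts.

## References

* [ArnoldGuseinzadeVarchenko2012] V. I. Arnold, S. M. Gusein-Zade, A. N. Varchenko, Singularities of Differentiable Maps II (2012), Part I §1.1, §2.1.
* [Milnor1968] J. Milnor, Singular Points of Complex Hypersurfaces, §9 Lemma 9.4.
* [CarlsonToledo1999] J. A. Carlson, D. Toledo, Duke Math. J. 97 (1999), §6 (kdoublept).
-/

noncomputable section

open CategoryTheory AlgebraicGeometry MvPolynomial TopologicalSpace Set Topology Filter
open scoped Manifold ContDiff
open Literature.AlgebraicGeometry.Motives Literature.AlgebraicGeometry.Motives.UniversalHypersurface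
open Literature.AlgebraicGeometry.HodgeTheory.UniversalHypersurface Literature.Geometry.ComplexAnalytic Literature.Geometry.Manifold

namespace Literature.AlgebraicGeometry.HodgeTheory

/-! ### Restricted self-maps -/

section RestrictIf

variable {α : Type*} (s : Set α) (f : α → α)

open scoped Classical in
/-- **The self-map of `s` induced by `f` where `f` stays in `s`**: `x ↦ f x` if `f x ∈ s`, `x ↦ x` otherwise.
[cite: ArnoldGuseinzadeVarchenko2012, Part I §1.1] -/
def restrictIf (x : s) : s :=
  if h : f x.1 ∈ s then ⟨f x.1, h⟩ else x

/-- Where `f x ∈ s`, `restrictIf s f x = f x`. [cite: ArnoldGuseinzadeVarchenko2012, Part I §1.1] -/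
theorem restrictIf_coe {x : s} (h : f x.1 ∈ s) : (restrictIf s f x : α) = f x.1 := by
  classical
  simp [restrictIf, h]

/-- Where `f x ∉ s`, `restrictIf s f x = x`. [cite: ArnoldGuseinzadeVarchenko2012, Part I §1.1] -/
theorem restrictIf_of_not_mem {x : s} (h : f x.1 ∉ s) : restrictIf s f x = x := by
  classical
  simp [restrictIf, h]

/-- If `f x = x` then `restrictIf s f x = x`. [cite: ArnoldGuseinzadeVarchenko2012, Part I §1.1] -/
theorem restrictIf_of_apply_eq {x : s} (h : f x.1 = x.1) : restrictIf s f x = x := by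
  classical
  by_cases hm : f x.1 ∈ s
  · exact Subtype.ext (by rw [restrictIf_coe s f hm, h])
  · exact restrictIf_of_not_mem s f hm

end RestrictIf

/-! ### The pencil slice -/

section Slice

variable (p : ℕ)

/-- **The pencil slice** `S = {Q ∈ 𝒴°(ℂ) | b_m(Q) = b_m(x₃^p − f₁), m ≠ x₂^p}`: the members `x₃^p = f₁ + c·x₂^p` of the pencil,
read inside the regular locus of the universal family. [cite: CarlsonToledo1999, §6 (kdoublept)]
[cite: ArnoldGuseinzadeVarchenko2012, Part I §2.1] -/
def pencilSlice : Set (ComplexPoints (regularTotal ℂ 2 p)) :=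
  {Q | ∀ m : {m : DegIndex 2 p // m ≠ regPowIndex 2 p 2},
    regCoeff ℂ 2 p Q m.1 = coeffsOf 2 p (cyclicCoverForm p (X 2 ^ (p - 2) * (X 0 * X 1) + X 0 ^ p + X 1 ^ p)) m.1}

/-- Membership in the slice, unfolded. [cite: CarlsonToledo1999, §6 (kdoublept)] -/
theorem mem_pencilSlice_iff (Q : ComplexPoints (regularTotal ℂ 2 p)) :
    Q ∈ pencilSlice p ↔ ∀ m : {m : DegIndex 2 p // m ≠ regPowIndex 2 p 2},
      regCoeff ℂ 2 p Q m.1 = coeffsOf 2 p (cyclicCoverForm p (X 2 ^ (p - 2) * (X 0 * X 1) + X 0 ^ p + X 1 ^ p)) m.1 :=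
  Iff.rfl

/-- **The coefficient map `Q ↦ b(Q)` is continuous on `𝒴°(ℂ)`** (`p ≥ 1`; it is `C^∞`, `contMDiffAt_regCoeff`).
[cite: VoisinHodgeII2003, §6.2.1] -/
theorem continuous_regCoeff (hd : 0 < p) : Continuous fun Q : ComplexPoints (regularTotal ℂ 2 p) => regCoeff ℂ 2 p Q := by
  haveI := locallyOfFiniteType_regularTotal_hom ℂ 2 p hd
  haveI := smoothOfRelativeDimension_regularTotal_hom ℂ 2 p hd
  letI := ComplexPoints.chartedSpace (regularTotal ℂ 2 p) (2 + Fintype.card (DegIndex 2 p))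
  haveI := ComplexPoints.isManifold_real (regularTotal ℂ 2 p) (2 + Fintype.card (DegIndex 2 p))
  exact continuous_iff_continuousAt.mpr fun Q => (contMDiffAt_regCoeff 2 p hd Q).continuousAt

/-- **The pencil coordinate `c(Q) = −b_{x₂^p}(Q)` is continuous** (`p ≥ 1`). [cite: CarlsonToledo1999, §6 (kdoublept)] -/
theorem continuous_pencilCoord (hd : 0 < p) : Continuous (pencilCoord p) :=
  ((continuous_apply (regPowIndex 2 p 2)).comp (continuous_regCoeff p hd)).neg

/-- **The slice is closed** (a level set of finitely many continuous coefficient functions). [cite: CarlsonToledo1999, §6 (kdoublept)] -/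
theorem isClosed_pencilSlice (hd : 0 < p) : IsClosed (pencilSlice p) := by
  have h : pencilSlice p = ⋂ m : {m : DegIndex 2 p // m ≠ regPowIndex 2 p 2},
      {Q | regCoeff ℂ 2 p Q m.1 = coeffsOf 2 p (cyclicCoverForm p (X 2 ^ (p - 2) * (X 0 * X 1) + X 0 ^ p + X 1 ^ p)) m.1} := by
    ext Q; simp [pencilSlice]
  rw [h]
  exact isClosed_iInter fun m =>
    isClosed_eq ((continuous_apply m.1).comp (continuous_regCoeff p hd)) continuous_const

variable (Θ : OpenPartialHomeomorph (Fin (1 + 2) → ℂ) (Fin (1 + 2) → ℂ)) (R''' R'' : ℝ)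

/-- `invariantSet = pencilSlice ∩ {s₁² < F}`. [cite: ArnoldGuseinzadeVarchenko2012, Part I §2.1] -/
theorem mem_invariantSet_iff (s₁ : ℝ) (Q : ComplexPoints (regularTotal ℂ 2 p)) :
    Q ∈ invariantSet p Θ R''' R'' s₁ ↔ Q ∈ pencilSlice p ∧ s₁ ^ 2 < satRadius p Θ R''' R'' Q :=
  Iff.rfl

/-- **The saturated radius is continuous** (`p ≥ 1`, `Θ` smooth on its source, `{Σ|z|² ≤ R''} ⊆ Θ.target`, `R''' < R''`;
it is `C^∞`, `contMDiff_satRadius`). [cite: ArnoldGuseinzadeVarchenko2012, Part I §2.1] -/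
theorem continuous_satRadius (hd : 0 < p) (hΘ : ContDiffOn ℝ ∞ Θ Θ.source) (hR : R''' < R'')
    (hR'' : {z : Fin (1 + 2) → ℂ | ∑ i, ‖z i‖ ^ 2 ≤ R''} ⊆ Θ.target) :
    Continuous (satRadius p Θ R''' R'') := by
  haveI := locallyOfFiniteType_regularTotal_hom ℂ 2 p hd
  haveI := smoothOfRelativeDimension_regularTotal_hom ℂ 2 p hd
  letI := ComplexPoints.chartedSpace (regularTotal ℂ 2 p) (2 + Fintype.card (DegIndex 2 p))
  haveI := ComplexPoints.isManifold_real (regularTotal ℂ 2 p) (2 + Fintype.card (DegIndex 2 p))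
  exact (contMDiff_satRadius p Θ R''' R'' hd hΘ hR hR'').continuous

/-- **`F ≥ 0`** when `0 ≤ R''` and `R''' < R''` (`F = R''` off the Morse region, `F ≥ min(R'', Σ|Θy|²)` inside).
[cite: ArnoldGuseinzadeVarchenko2012, Part I §2.1] -/
theorem satRadius_nonneg (hR : R''' < R'') (h0 : 0 ≤ R'') (Q : ComplexPoints (regularTotal ℂ 2 p)) :
    0 ≤ satRadius p Θ R''' R'' Q := by
  by_cases hQ : Q ∈ regChartDom 2 p 2
  · rw [satRadius_of_mem p Θ R''' R'' hQ]
    by_cases hy : (fun j => regChartFun 2 p 2 Q (Sum.inr j)) ∈ Θ.source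
    · refine le_trans (le_min h0 ?_) (PhamBrieskorn.min_le_sub_radiusDefect Θ R''' R'' hR hy)
      exact Finset.sum_nonneg fun i _ => by positivity
    · rw [PhamBrieskorn.radiusDefect_of_not_mem Θ R''' R'' hy, sub_zero]; exact h0
  · rw [satRadius_of_not_mem p Θ R''' R'' hQ]; exact h0

/-! ### The cut radius -/

variable (T ρW : ℝ)

/-- **The cut radius** `max (F(Q)) (T · σ(4|c(Q)|/ρW − 1))` (`σ` = `Real.smoothTransition`): equal to `F` over the disc `|c| ≤ ρW/4`,
at least `T` off the disc `|c| < ρW/2`. [cite: ArnoldGuseinzadeVarchenko2012, Part I §1.1] -/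
def cutRadius (Q : ComplexPoints (regularTotal ℂ 2 p)) : ℝ :=
  max (satRadius p Θ R''' R'' Q) (T * Real.smoothTransition (4 * ‖pencilCoord p Q‖ / ρW - 1))

/-- `F ≤ cutRadius`. [cite: ArnoldGuseinzadeVarchenko2012, Part I §1.1] -/
theorem satRadius_le_cutRadius (Q : ComplexPoints (regularTotal ℂ 2 p)) :
    satRadius p Θ R''' R'' Q ≤ cutRadius p Θ R''' R'' T ρW Q :=
  le_max_left _ _

/-- **Over the small disc the cut radius is the saturated Morse radius**: `|c(Q)| ≤ ρW/4`, `ρW > 0`, `F(Q) ≥ 0` ⇒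
`cutRadius Q = F(Q)`. [cite: ArnoldGuseinzadeVarchenko2012, Part I §1.1] -/
theorem cutRadius_eq_of_norm_le (hρW : 0 < ρW) {Q : ComplexPoints (regularTotal ℂ 2 p)} (hQ : ‖pencilCoord p Q‖ ≤ ρW / 4)
    (hF : 0 ≤ satRadius p Θ R''' R'' Q) :
    cutRadius p Θ R''' R'' T ρW Q = satRadius p Θ R''' R'' Q := by
  have harg : 4 * ‖pencilCoord p Q‖ / ρW - 1 ≤ 0 := by
    rw [sub_nonpos, div_le_one hρW]; linarith
  rw [cutRadius, Real.smoothTransition.zero_of_nonpos harg, mul_zero, max_eq_left hF]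

/-- **The ball `{cutRadius < T}` lies over the disc `|c| < ρW/2`** (`ρW > 0`). [cite: ArnoldGuseinzadeVarchenko2012, Part I §1.1] -/
theorem norm_lt_of_cutRadius_lt (hρW : 0 < ρW) {Q : ComplexPoints (regularTotal ℂ 2 p)}
    (hQ : cutRadius p Θ R''' R'' T ρW Q < T) : ‖pencilCoord p Q‖ < ρW / 2 := by
  have h1 : T * Real.smoothTransition (4 * ‖pencilCoord p Q‖ / ρW - 1) < T := lt_of_le_of_lt (le_max_right _ _) hQ
  have h2 : Real.smoothTransition (4 * ‖pencilCoord p Q‖ / ρW - 1) < 1 := by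
    by_contra h
    have h' : Real.smoothTransition (4 * ‖pencilCoord p Q‖ / ρW - 1) = 1 :=
      le_antisymm (Real.smoothTransition.le_one _) (not_lt.mp h)
    rw [h', mul_one] at h1
    exact lt_irrefl _ h1
  have h3 : 4 * ‖pencilCoord p Q‖ / ρW - 1 < 1 := by
    by_contra h
    exact absurd (Real.smoothTransition.one_of_one_le (not_lt.mp h)) h2.ne
  rw [sub_lt_iff_lt_add, div_lt_iff₀ hρW] at h3
  linarith

/-- `F < T` on the ball `{cutRadius < T}`. [cite: ArnoldGuseinzadeVarchenko2012, Part I §1.1] -/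
theorem satRadius_lt_of_cutRadius_lt {Q : ComplexPoints (regularTotal ℂ 2 p)} (hQ : cutRadius p Θ R''' R'' T ρW Q < T) :
    satRadius p Θ R''' R'' Q < T :=
  lt_of_le_of_lt (satRadius_le_cutRadius p Θ R''' R'' T ρW Q) hQ

/-- **The cut radius is continuous** (`p ≥ 1`, `Θ` smooth, `{Σ|z|² ≤ R''} ⊆ Θ.target`, `R''' < R''`).
[cite: ArnoldGuseinzadeVarchenko2012, Part I §1.1] -/
theorem continuous_cutRadius (hd : 0 < p) (hΘ : ContDiffOn ℝ ∞ Θ Θ.source) (hR : R''' < R'')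
    (hR'' : {z : Fin (1 + 2) → ℂ | ∑ i, ‖z i‖ ^ 2 ≤ R''} ⊆ Θ.target) :
    Continuous (cutRadius p Θ R''' R'' T ρW) := by
  refine (continuous_satRadius p Θ R''' R'' hd hΘ hR hR'').max (continuous_const.mul ?_)
  exact Real.smoothTransition.continuous.comp
    ((((continuous_const.mul (continuous_pencilCoord p hd).norm).div_const ρW)).sub continuous_const)

end Slice

end Literature.AlgebraicGeometry.HodgeTheory

end
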